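import Literature.Barriers.CriticalPhenomena.GaussianDominationRouteLaceExpansion
import Literature.Probability.Percolation.InfraredTriangleAnalysis
import Mathlib.Analysis.Normed.Group.Tannery
import HarnessLib

/-!
# Towards `HaraSlade1990_infraredBound_holds`, VIII: Prop. 8.3 ("Consequences of the bootstrap
# bound") PROVED from Prop. 6.1, the remainder bound (6.3.2), Lemma 8.4 and the spatial symmetry
# of the lace-expansion coefficients

Sibling proof file of `GaussianDominationRouteLaceExpansion.lean` (barrier catalogue
`Literature/Barriers/CriticalPhenomena/`), which defines the inclusion–exclusion lace expansion
of Hara–Slade for bond percolation on `ℤ^d` (`Π^{(N)} = lacePi`, `Π_M = lacePiM`, `R_M = laceR`,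
`J = bondJ`) and vendors Heydenreich–van der Hofstad's Prop. 6.1 (`HvdH2017_prop61`), (6.3.2)
(`HvdH2017_eq632`), Lemma 8.4 (`HvdH2017_lemma84`) and the symmetry `Π^{(N)}(-x) = Π^{(N)}(x)`
(`HvdH2017_piN_symm`) as named facts. Here the printed "Proof of Prop. 8.3 subject to Lem. 8.4"
(p. 110 of the book) is carried out, giving

* `HvdH2017_prop83_of_prop61_eq632_lemma84 : HvdH2017_prop61 → HvdH2017_eq632 → HvdH2017_lemma84 →
  HvdH2017_piN_symm → HvdH2017_prop83`, and hence
* `HaraSlade1990_infraredBound_of_prop61_eq632_lemma84` — the Hara–Slade infrared bound (HvdH Thm. 5.1)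
  reduced to these four facts (everything else in Chs. 5–8 being formal:
  `HaraSlade1990_infraredBound_of_prop83` of `GaussianDominationRouteF3.lean`).

## The proof (namespace `Literature.Barriers.CriticalPhenomena`)

With `c̄ = c̄_{K∨1}`, `d ≥ d₀(K∨1) ∨ 2c̄` and `ε = c̄/d ≤ 1/2`, (8.3.5) gives the summable majorant
`G(x) = Σ_N Π^{(N)}(x)` with `Σ_x G ≤ Σ_N ε^{N∨1} = ε + ε/(1-ε) ≤ 3ε` (`hasSum_pow_max_one`,
Tonelli for the non-negative double series, `summable_prod_of_nonneg`), so
`Π = Σ_N (-1)^N Π^{(N)}` is symmetric, summable, `Σ|Π| ≤ 4c̄/d` **(8.3.1)**, and likewise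
`Σ_x [1 - cos(k·x)]|Π(x)| ≤ [1 - D̂(k)] Σ_N ε^{(N-1)∨1} ≤ (4c̄/d)[1 - D̂(k)]` **(8.3.2)** by (8.3.6).
In (6.2.2), `Π_M(x) → Π(x)`, `(Π_M ⋆ J ⋆ τ)(x) → (Π ⋆ J ⋆ τ)(x)` by dominated convergence (majorant
`2dp·G`, `J ⋆ τ ≤ 2dp`), and `|R_M(x)| ≤ (Π^{(M)} ⋆ J ⋆ τ)(x) ≤ 2dp ε^M → 0` by (6.3.2) ((6.3.4)),
whence **(6.1.2)** `τ = δ + J⋆τ + Π⋆(J⋆τ) + Π`. Its cosine transform — `cosFT` is additive,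
`δ̂ = 1`, and the CONVOLUTION THEOREM `(f ⋆ g)^ = f̂ ĝ` for summable `f, g` with `g` symmetric
(`cosFT_latticeConv`, the sine part vanishing), with `Ĵ = 2dp D̂` (`cosFT_bondJ`, via
`J = hvdhA (2dp) 0` and `cosFT_hvdhA`) — is `τ̂ = 1 + 2dpD̂τ̂ + Π̂·2dpD̂τ̂ + Π̂`, i.e. the
multiplied-out (6.1.3)/(8.3.4) `τ̂(1 - 2dpD̂[1 + Π̂]) = 1 + Π̂` required by `HvdH2017_prop83`.

Relation to `GaussianDominationRouteExpansion.lean` (a sibling landed concurrently, which vendors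
Prop. 6.1 + (6.3.2) + Lemma 8.4 TOGETHER, in existential form over an abstract family `(Π^{(N)})_N`,
as `HvdH2017_prop61_lemma84`, and proves `HvdH2017_prop83` from it): the present file works with
the DEFINED coefficients `lacePi` of `GaussianDominationRouteLaceExpansion.lean` and the four
separate facts about them, which is the form in which they can be discharged; note that the
remainder bound is used here in the corrected form `HvdH2017_eq632` (with `Π^{(M)} + δ_{M,0}δ_0`:
the printed (6.3.2) omits the `u = 0` term at `M = 0`, see the docstring of `HvdH2017_eq632`),
of which only `M ≥ 1` enters the limit `M → ∞`.

Also proved: the signed `ℓ¹` convolution calculus (`summable_latticeConv_of_summable`,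
`latticeConv_neg`), `J = p Σ_j [𝟙{· = e_j} + 𝟙{· = -e_j}]` (`bondJ_eq_mul_sum_ite`), `Σ J ≤ 2dp`,
`J ⋆ g ≤ 2dp` for `0 ≤ g ≤ 1`.

## References

* M. Heydenreich, R. van der Hofstad, *Progress in High-Dimensional Percolation and Random
  Graphs* (Springer 2017): Prop. 8.3 and its proof subject to Lemma 8.4 (p. 110), (6.1.2)–(6.1.3),
  (6.2.1)–(6.2.3), (6.3.2)–(6.3.4), (8.3.1)–(8.3.6), (1.2.16)–(1.2.18).
* T. Hara, G. Slade, Comm. Math. Phys. 128 (1990) 333–391: Prop. 2.3, Lemma 4.5, Thm. 1.1.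
-/

noncomputable section

namespace Literature.Barriers.CriticalPhenomena

open MeasureTheory Filter Topology Literature.Probability.LatticeModels Literature.Probability.Percolation
open SpreadOutIsing (delta0 latticeConv)
open scoped BigOperators ENNReal

variable {d : ℕ}

/-! ### `J`: the finite neighbour sum, its transform `Ĵ = 2dp D̂`, and `J ⋆ g ≤ 2dp` -/

/-- `x ↦ sin(k·x) f(x)` is summable when `f` is. [folklore] -/
theorem summable_sin_kdot_mul {f : Site d → ℝ} (hf : Summable f) (k : Fin d → ℝ) :
    Summable fun x => Real.sin (kdot k x) * f x :=
  Summable.of_norm_bounded hf.norm fun x => by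
    rw [Real.norm_eq_abs, abs_mul, Real.norm_eq_abs]
    exact mul_le_of_le_one_left (abs_nonneg _) (Real.abs_sin_le_one _)

/-- The unit vectors `e_i` are pairwise distinct and distinct from the `-e_j`. [folklore] -/
theorem single_one_ne_neg_single_one (i j : Fin d) :
    (Pi.single i (1 : ℤ) : Site d) ≠ -Pi.single j 1 := by
  intro h
  have := congrFun h i
  simp only [Pi.single_eq_same, Pi.neg_apply] at this
  by_cases hij : i = j
  · subst hij; simp at this
  · rw [Pi.single_eq_of_ne hij] at this; simp at this

/-- `e_i = e_j ↔ i = j`. [folklore] -/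
theorem single_one_eq_single_one_iff (i j : Fin d) :
    (Pi.single i (1 : ℤ) : Site d) = Pi.single j 1 ↔ i = j := by
  refine ⟨fun h => ?_, fun h => by rw [h]⟩
  by_contra hij
  have := congrFun h i
  rw [Pi.single_eq_same, Pi.single_eq_of_ne hij] at this
  exact one_ne_zero this

/-- `J(x) = p Σ_j [𝟙{x = e_j} + 𝟙{x = -e_j}]` — the indicator of the `2d` neighbours of `0`
written coordinatewise. [cite: HeydenreichVanDerHofstad2017, (6.2.1) and (1.2.18)] -/
theorem bondJ_eq_mul_sum_ite (p : unitInterval) (x : Site d) :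
    bondJ d p x = (p : ℝ) * ∑ j : Fin d,
      ((if x = Pi.single j 1 then (1 : ℝ) else 0) + (if x = -Pi.single j 1 then (1 : ℝ) else 0)) := by
  rw [bondJ_def]
  by_cases hx : (zdGraph d).Adj 0 x
  · rw [if_pos hx]
    obtain ⟨i, hi⟩ := (zdGraph_adj_iff 0 x).1 hx
    simp only [zero_add] at hi
    rcases hi with hi | hi
    · -- `x = e_i`
      subst hi
      have h1 : ∀ j : Fin d, (if (Pi.single i (1 : ℤ) : Site d) = -Pi.single j 1 then (1 : ℝ) else 0) = 0 :=
        fun j => if_neg (single_one_ne_neg_single_one i j)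
      simp only [h1, add_zero, single_one_eq_single_one_iff, Finset.sum_ite_eq, Finset.mem_univ,
        if_true, mul_one]
    · -- `x = -e_i`
      have hx' : x = -Pi.single i 1 := eq_neg_of_add_eq_zero_left hi.symm
      subst hx'
      have h1 : ∀ j : Fin d, (if (-Pi.single i (1 : ℤ) : Site d) = Pi.single j 1 then (1 : ℝ) else 0) = 0 :=
        fun j => if_neg fun h => single_one_ne_neg_single_one j i h.symm
      have h2 : ∀ j : Fin d, ((-Pi.single i (1 : ℤ) : Site d) = -Pi.single j 1) ↔ i = j := fun j => by
        rw [neg_inj, single_one_eq_single_one_iff]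
      simp only [h1, zero_add, h2, Finset.sum_ite_eq, Finset.mem_univ, if_true, mul_one]
  · rw [if_neg hx]
    have h1 : ∀ j : Fin d, (if x = Pi.single j 1 then (1 : ℝ) else 0) = 0 := fun j => by
      refine if_neg fun h => hx ?_
      rw [zdGraph_adj_iff]; exact ⟨j, Or.inl (by simpa using h)⟩
    have h2 : ∀ j : Fin d, (if x = -Pi.single j 1 then (1 : ℝ) else 0) = 0 := fun j => by
      refine if_neg fun h => hx ?_
      rw [zdGraph_adj_iff]; exact ⟨j, Or.inr (by simp [h])⟩
    simp [h1, h2]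

/-- `J = q(D + D ⋆ 0) = hvdhA (2dp) 0` (`d ≥ 1`). [cite: HeydenreichVanDerHofstad2017, (6.2.1)] -/
theorem hvdhA_zero_eq_bondJ (hd : 1 ≤ d) (p : unitInterval) (x : Site d) :
    hvdhA (2 * d * (p : ℝ)) (fun _ => 0) x = bondJ d p x := by
  rw [hvdhA_def, bondJ_eq_mul_sum_ite]
  have hd' : (d : ℝ) ≠ 0 := by exact_mod_cast (show d ≠ 0 by omega)
  simp only [add_zero]
  field_simp

/-- **`Ĵ(k) = 2dp D̂(k)`** (`d ≥ 1`). [cite: HeydenreichVanDerHofstad2017, (6.1.3) (the transform of J⋆τ is 2dpD̂τ̂)] -/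
theorem cosFT_bondJ [NeZero d] (p : unitInterval) (k : Fin d → ℝ) :
    cosFT (bondJ d p) k = 2 * d * (p : ℝ) * Dhat d k := by
  have hd : 1 ≤ d := Nat.one_le_iff_ne_zero.2 (NeZero.ne d)
  have hfun : bondJ d p = hvdhA (2 * d * (p : ℝ)) (fun _ => (0 : ℝ)) :=
    funext fun x => (hvdhA_zero_eq_bondJ hd p x).symm
  have h0 : cosFT (fun _ : Site d => (0 : ℝ)) k = 0 := by simp [cosFT]
  rw [hfun, cosFT_hvdhA (P := fun _ => (0 : ℝ)) (summable_zero) (fun _ => rfl), h0, add_zero, mul_one]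

/-- `J` is summable (finitely supported). [folklore] -/
theorem summable_bondJ (hd : 1 ≤ d) (p : unitInterval) : Summable (bondJ d p) := by
  have : bondJ d p = fun x => 2 * d * (p : ℝ) * srwStep d x := funext (bondJ_eq_srwStep hd p)
  rw [this]
  exact summable_srwStep.mul_left _

/-- `Σ_x J(x) ≤ 2dp`. [cite: HeydenreichVanDerHofstad2017, (6.2.1) (Σ J = 2dp)] -/
theorem tsum_bondJ_le (hd : 1 ≤ d) (p : unitInterval) : ∑' x, bondJ d p x ≤ 2 * d * (p : ℝ) := by
  have : bondJ d p = fun x => 2 * d * (p : ℝ) * srwStep d x := funext (bondJ_eq_srwStep hd p)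
  rw [this, tsum_mul_left]
  have hq : (0 : ℝ) ≤ 2 * d * (p : ℝ) := by have := p.2.1; positivity
  calc 2 * d * (p : ℝ) * ∑' x, srwStep d x ≤ 2 * d * (p : ℝ) * 1 :=
        mul_le_mul_of_nonneg_left tsum_srwStep_le_one hq
    _ = 2 * d * (p : ℝ) := mul_one _

/-- **`(J ⋆ g)(x) ≤ 2dp` for `0 ≤ g ≤ 1`** (e.g. `J ⋆ τ ≤ 2dp`). [cite: HeydenreichVanDerHofstad2017, (6.3.2)] -/
theorem latticeConv_bondJ_le (hd : 1 ≤ d) (p : unitInterval) {g : Site d → ℝ} (hg0 : ∀ x, 0 ≤ g x)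
    (hg1 : ∀ x, g x ≤ 1) (x : Site d) : latticeConv (bondJ d p) g x ≤ 2 * d * (p : ℝ) :=
  calc latticeConv (bondJ d p) g x ≤ (∑' y, bondJ d p y) * 1 :=
        latticeConv_le_tsum_mul (summable_bondJ hd p) (bondJ_nonneg p) hg0 hg1 x
    _ ≤ 2 * d * (p : ℝ) := by rw [mul_one]; exact tsum_bondJ_le hd p

/-! ### The `ℓ¹` convolution calculus for signed functions and the convolution theorem for `cosFT` -/

section ConvSigned

variable {f g : Site d → ℝ}

/-- For summable `f, g : ℤ^d → ℝ` the family `(x, y) ↦ f(y) g(x - y)` is summable. [folklore] -/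
theorem summable_latticeConv_family_of_summable (hf : Summable f) (hg : Summable g) :
    Summable fun xy : Site d × Site d => f xy.2 * g (xy.1 - xy.2) := by
  have hprod : Summable fun yv : Site d × Site d => f yv.1 * g yv.2 :=
    summable_mul_of_summable_norm hf.norm hg.norm
  let e : Site d × Site d ≃ Site d × Site d :=
    { toFun := fun yv => (yv.1 + yv.2, yv.1)
      invFun := fun xy => (xy.2, xy.1 - xy.2)
      left_inv := fun yv => by simp
      right_inv := fun xy => by simp }
  rw [← e.summable_iff]
  exact hprod.congr fun yv => by simp [e]

/-- The convolution of summable functions is summable. [folklore] -/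
theorem summable_latticeConv_of_summable (hf : Summable f) (hg : Summable g) :
    Summable (latticeConv f g) :=
  (summable_latticeConv_family_of_summable hf hg).prod

/-- For fixed `x` the family `y ↦ f(y) g(x - y)` is summable. [folklore] -/
theorem summable_latticeConv_inner_of_summable (hf : Summable f) (hg : Summable g) (x : Site d) :
    Summable fun y => f y * g (x - y) :=
  (summable_latticeConv_family_of_summable hf hg).prod_factor x

/-- The convolution of two symmetric functions is symmetric. [folklore] -/
theorem latticeConv_neg (hfs : ∀ x, f (-x) = f x) (hgs : ∀ x, g (-x) = g x) (x : Site d) :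
    latticeConv f g (-x) = latticeConv f g x := by
  unfold latticeConv
  rw [← (Equiv.neg (Site d)).tsum_eq]
  refine tsum_congr fun y => ?_
  rw [Equiv.neg_apply, hfs, show -x - -y = -(x - y) by abel, hgs]

/-- **The convolution theorem for the cosine transform**: for summable `f, g` with `g` symmetric,
`(f ⋆ g)^(k) = f̂(k) ĝ(k)` (the sine part of `ĝ` vanishing by symmetry).
[cite: HeydenreichVanDerHofstad2017, (1.2.16)–(1.2.17) and (6.1.3)] -/
theorem cosFT_latticeConv (hf : Summable f) (hg : Summable g) (hgs : ∀ x, g (-x) = g x)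
    (k : Fin d → ℝ) : cosFT (latticeConv f g) k = cosFT f k * cosFT g k := by
  have hfam := summable_latticeConv_family_of_summable hf hg
  -- the family `(x, y) ↦ cos(k·x) f(y) g(x - y)`
  have hF' : Summable fun xy : Site d × Site d => Real.cos (kdot k xy.1) * (f xy.2 * g (xy.1 - xy.2)) :=
    Summable.of_norm_bounded (g := fun xy : Site d × Site d => ‖f xy.2 * g (xy.1 - xy.2)‖) hfam.norm
      fun xy => by
        rw [norm_mul]
        exact mul_le_of_le_one_left (norm_nonneg _) (Real.abs_cos_le_one _)
  have hF : Summable (Function.uncurry fun x y : Site d => Real.cos (kdot k x) * (f y * g (x - y))) := hF'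
  calc cosFT (latticeConv f g) k
      = ∑' x, ∑' y, Real.cos (kdot k x) * (f y * g (x - y)) := by
        simp only [cosFT, latticeConv, ← tsum_mul_left]
    _ = ∑' y, ∑' x, Real.cos (kdot k x) * (f y * g (x - y)) := hF.tsum_comm.symm
    _ = ∑' y, f y * (Real.cos (kdot k y) * cosFT g k) := by
        refine tsum_congr fun y => ?_
        have e1 : (fun x => Real.cos (kdot k x) * (f y * g (x - y))) =
            fun x => f y * (Real.cos (kdot k x) * g (x - y)) := funext fun x => by ring
        rw [e1, tsum_mul_left]
        congr 1
        rw [tsum_mul_shift_sub (fun x => Real.cos (kdot k x)) g y]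
        have e2 : (fun z => Real.cos (kdot k (z + y)) * g z) =
            fun z => Real.cos (kdot k y) * (Real.cos (kdot k z) * g z) -
              Real.sin (kdot k y) * (Real.sin (kdot k z) * g z) := funext fun z => by
          rw [Literature.Probability.Percolation.kdot_add, Real.cos_add]; ring
        rw [e2, ((summable_cos_kdot_mul hg k).mul_left _).tsum_sub
          ((summable_sin_kdot_mul hg k).mul_left _), tsum_mul_left, tsum_mul_left,
          tsum_sin_kdot_mul_eq_zero hgs, mul_zero, sub_zero, cosFT]
    _ = cosFT f k * cosFT g k := by
        simp only [cosFT]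
        rw [← tsum_mul_right]
        exact tsum_congr fun y => by ring

/-- `cosFT` is additive on summable functions. [folklore] -/
theorem cosFT_add (hf : Summable f) (hg : Summable g) (k : Fin d → ℝ) :
    cosFT (fun x => f x + g x) k = cosFT f k + cosFT g k := by
  simp only [cosFT, mul_add]
  exact (summable_cos_kdot_mul hf k).tsum_add (summable_cos_kdot_mul hg k)

end ConvSigned

/-- `δ̂ = 1`. [folklore] -/
theorem cosFT_delta0 (k : Fin d → ℝ) : cosFT (delta0 : Site d → ℝ) k = 1 := by
  rw [cosFT]
  have : (fun x : Site d => Real.cos (kdot k x) * delta0 x) = fun x => if x = 0 then 1 else 0 :=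
    funext fun x => by unfold delta0; split_ifs with h <;> simp [h]
  rw [this, tsum_ite_eq]

/-- `τ_p(0, ·)` is symmetric. [folklore] -/
theorem tau_zero_symm (p : unitInterval) : ∀ x : Site d, tau d p 0 (-x) = tau d p 0 x :=
  tau_zero_neg p

/-! ### The geometric sums `Σ_N ε^{N∨1}` and `Σ_N ε^{(N-1)∨1}` -/

section Geometric

variable {ε : ℝ}

/-- `Σ_N ε^{N∨1} = ε + ε/(1-ε)` for `0 ≤ ε < 1`. [cite: HeydenreichVanDerHofstad2017, proof of Prop. 8.3 ("summing the geometric series")] -/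
theorem hasSum_pow_max_one (hε0 : 0 ≤ ε) (hε1 : ε < 1) :
    HasSum (fun N : ℕ => ε ^ max N 1) (ε + ε / (1 - ε)) := by
  rw [← hasSum_nat_add_iff' 1]
  have e : (fun N : ℕ => ε ^ max (N + 1) 1) = fun N => ε * ε ^ N := funext fun N => by
    rw [show max (N + 1) 1 = N + 1 by omega, pow_succ']
  rw [e, show ε + ε / (1 - ε) - ∑ i ∈ Finset.range 1, ε ^ max i 1 = ε * (1 - ε)⁻¹ by
    simp only [Finset.sum_range_one, Nat.zero_max, pow_one]; ring]
  exact (hasSum_geometric_of_lt_one hε0 hε1).mul_left ε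

/-- `Σ_N ε^{(N-1)∨1} = 2ε + ε/(1-ε)` for `0 ≤ ε < 1` (truncated subtraction: the `N = 0, 1, 2` terms
are all `ε`). [cite: HeydenreichVanDerHofstad2017, proof of Prop. 8.3 ("summing the geometric series")] -/
theorem hasSum_pow_max_sub_one (hε0 : 0 ≤ ε) (hε1 : ε < 1) :
    HasSum (fun N : ℕ => ε ^ max (N - 1) 1) (2 * ε + ε / (1 - ε)) := by
  rw [← hasSum_nat_add_iff' 2]
  have e : (fun N : ℕ => ε ^ max (N + 2 - 1) 1) = fun N => ε * ε ^ N := funext fun N => by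
    rw [show max (N + 2 - 1) 1 = N + 1 by omega, pow_succ']
  rw [e, show 2 * ε + ε / (1 - ε) - ∑ i ∈ Finset.range 2, ε ^ max (i - 1) 1 = ε * (1 - ε)⁻¹ by
    simp only [Finset.sum_range_succ, Finset.sum_range_zero, zero_add, Nat.sub_self, Nat.zero_sub,
      Nat.zero_max, pow_one]; ring]
  exact (hasSum_geometric_of_lt_one hε0 hε1).mul_left ε

/-- `Σ_N ε^{N∨1} ≤ 3ε` for `0 ≤ ε ≤ 1/2`. [cite: HeydenreichVanDerHofstad2017, proof of Prop. 8.3 (c_K = 4c̄_K)] -/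
theorem tsum_pow_max_one_le (hε0 : 0 ≤ ε) (hε : ε ≤ 1 / 2) : ∑' N : ℕ, ε ^ max N 1 ≤ 3 * ε := by
  rw [(hasSum_pow_max_one hε0 (by linarith)).tsum_eq]
  have h1 : ε / (1 - ε) ≤ 2 * ε := by
    rw [div_le_iff₀ (by linarith)]; nlinarith
  linarith

/-- `Σ_N ε^{(N-1)∨1} ≤ 4ε` for `0 ≤ ε ≤ 1/2`. [cite: HeydenreichVanDerHofstad2017, proof of Prop. 8.3 (c_K = 4c̄_K)] -/
theorem tsum_pow_max_sub_one_le (hε0 : 0 ≤ ε) (hε : ε ≤ 1 / 2) :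
    ∑' N : ℕ, ε ^ max (N - 1) 1 ≤ 4 * ε := by
  rw [(hasSum_pow_max_sub_one hε0 (by linarith)).tsum_eq]
  have h1 : ε / (1 - ε) ≤ 2 * ε := by
    rw [div_le_iff₀ (by linarith)]; nlinarith
  linarith

end Geometric

/-! ### Prop. 8.3 from Prop. 6.1, (6.3.2), Lemma 8.4 and the symmetry of `Π^{(N)}` -/

section Assembly

variable {p : unitInterval} {ε : ℝ}

/-- The summable majorant `G(x) = Σ_N Π^{(N)}(x)` and the alternating sum
`Π(x) = Σ_N (-1)^N Π^{(N)}(x)` under the bounds (8.3.5): `Σ_x G(x) ≤ Σ_N ε^{N∨1}`, `Π` is summable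
with `|Π| ≤ G`. [cite: HeydenreichVanDerHofstad2017, proof of Prop. 8.3 and (6.3.3)] -/
theorem summable_lacePi_family (hsum : ∀ N, Summable (lacePi d p N))
    (hle : ∀ N, ∑' x, lacePi d p N x ≤ ε ^ max N 1) (hε0 : 0 ≤ ε) (hε1 : ε < 1) :
    Summable (Function.uncurry fun N x => lacePi d p N x) ∧
      ∑' N, ∑' x, lacePi d p N x ≤ ε + ε / (1 - ε) := by
  have hgeo := hasSum_pow_max_one hε0 hε1
  have hout : Summable fun N => ∑' x, lacePi d p N x :=
    Summable.of_nonneg_of_le (fun N => tsum_nonneg fun x => lacePi_nonneg p N x) hle hgeo.summable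
  have hfam : Summable (Function.uncurry fun N x => lacePi d p N x) :=
    (summable_prod_of_nonneg fun q => lacePi_nonneg p q.1 q.2).2 ⟨hsum, hout⟩
  refine ⟨hfam, ?_⟩
  rw [← hgeo.tsum_eq]
  exact hout.tsum_le_tsum hle hgeo.summable

/-- **Prop. 8.3 from Prop. 6.1, the remainder bound (6.3.2), Lemma 8.4 and the spatial symmetry
of the coefficients** — the printed "Proof of Prop. 8.3 subject to Lem. 8.4" (p. 110): the bounds
(8.3.1)–(8.3.2) with `c_K = 4c̄_K` by summing the geometric series over `N`; `Σ_x|R_M(x)| → 0` by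
(6.3.2) and (8.3.5) ((6.3.4)); hence (6.1.2) `τ = δ + J⋆τ + Π⋆J⋆τ + Π` with
`Π = Σ_N (-1)^N Π^{(N)}` (dominated convergence in (6.2.2)), and its Fourier transform (6.1.3) in
the multiplied-out form `τ̂(1 - 2dpD̂[1 + Π̂]) = 1 + Π̂` (the convolution theorem, `Ĵ = 2dpD̂`).
[cite: HeydenreichVanDerHofstad2017, Prop. 8.3 (proof subject to Lemma 8.4, p. 110), (6.1.2)–(6.1.3), (6.3.3)–(6.3.4)] -/
theorem HvdH2017_prop83_of_prop61_eq632_lemma84 (h61 : HvdH2017_prop61) (h632 : HvdH2017_eq632)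
    (h84 : HvdH2017_lemma84) (hsymm : HvdH2017_piN_symm) : HvdH2017_prop83 := by
  intro K
  obtain ⟨c, hc, d₀, hd₀6, H⟩ := h84 (max K 1) (lt_of_lt_of_le one_pos (le_max_right _ _))
  refine ⟨4 * c, by positivity, max d₀ (⌈2 * c⌉₊), fun d hd p hp hf => ?_⟩
  have hdd₀ : d₀ ≤ d := (le_max_left _ _).trans hd
  have hd2 : 2 ≤ d := by omega
  have hd1 : 1 ≤ d := by omega
  haveI : NeZero d := ⟨by omega⟩
  have hdpos : (0 : ℝ) < d := by exact_mod_cast (show 0 < d by omega)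
  -- `ε = c/d ∈ (0, 1/2]`
  set ε : ℝ := c / d with hεdef
  have hε0 : 0 ≤ ε := by positivity
  have hε : ε ≤ 1 / 2 := by
    rw [hεdef, div_le_iff₀ hdpos]
    have h1 : (2 * c : ℝ) ≤ ⌈2 * c⌉₊ := Nat.le_ceil _
    have h2 : ((⌈2 * c⌉₊ : ℕ) : ℝ) ≤ d := by exact_mod_cast (le_max_right _ _).trans hd
    linarith
  have hε1 : ε < 1 := by linarith
  have HN := H d hdd₀ p hp (hf.trans (le_max_left _ _))
  have hsum : ∀ N, Summable (lacePi d p N) := fun N => (HN N).1.1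
  have hle : ∀ N, ∑' x, lacePi d p N x ≤ ε ^ max N 1 := fun N => (HN N).1.2
  -- pointwise bound and summability in `N`
  have hpt : ∀ N x, lacePi d p N x ≤ ε ^ max N 1 := fun N x =>
    ((hsum N).le_tsum x fun y _ => lacePi_nonneg p N y).trans (hle N)
  have hgeo := hasSum_pow_max_one hε0 hε1
  have hsumN : ∀ x, Summable fun N => lacePi d p N x := fun x =>
    Summable.of_nonneg_of_le (fun N => lacePi_nonneg p N x) (fun N => hpt N x) hgeo.summable
  obtain ⟨hfam, hfam_le⟩ := summable_lacePi_family hsum hle hε0 hε1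
  -- the majorant `G` and the alternating sum `Π`
  set G : Site d → ℝ := fun x => ∑' N, lacePi d p N x with hGdef
  set Pf : Site d → ℝ := fun x => ∑' N, (-1 : ℝ) ^ N * lacePi d p N x with hPfdef
  have hG : Summable G := hfam.prod_symm.prod
  have hGsum : ∑' x, G x ≤ 3 * ε := by
    calc ∑' x, G x = ∑' N, ∑' x, lacePi d p N x := hfam.tsum_comm
      _ ≤ ε + ε / (1 - ε) := hfam_le
      _ ≤ 3 * ε := by
          have h1 : ε / (1 - ε) ≤ 2 * ε := by rw [div_le_iff₀ (by linarith)]; nlinarith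
          linarith
  have hG0 : ∀ x, 0 ≤ G x := fun x => tsum_nonneg fun N => lacePi_nonneg p N x
  have habsN : ∀ N x, |(-1 : ℝ) ^ N * lacePi d p N x| = lacePi d p N x := fun N x => by
    rw [abs_mul, abs_pow, abs_neg, abs_one, one_pow, one_mul, abs_of_nonneg (lacePi_nonneg p N x)]
  have hsumPfN : ∀ x, Summable fun N => (-1 : ℝ) ^ N * lacePi d p N x := fun x =>
    Summable.of_norm_bounded (hsumN x) fun N => by rw [Real.norm_eq_abs, habsN]
  have hPfG : ∀ x, |Pf x| ≤ G x := fun x => by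
    have h := norm_tsum_le_tsum_norm ((hsumN x).congr fun N => by rw [Real.norm_eq_abs, habsN])
    simp only [Real.norm_eq_abs, habsN] at h
    exact h
  have hPf : Summable Pf := Summable.of_norm_bounded hG fun x => by rw [Real.norm_eq_abs]; exact hPfG x
  have hPfsymm : ∀ x, Pf (-x) = Pf x := fun x => by
    simp only [hPfdef]; exact tsum_congr fun N => by rw [hsymm d p N x]
  refine ⟨Pf, hPfsymm, hPf, ?_, ?_, ?_⟩
  · -- (8.3.1): `Σ|Π| ≤ Σ G ≤ 3ε ≤ 4c/d`
    calc ∑' x, |Pf x| ≤ ∑' x, G x := hPf.abs.tsum_le_tsum hPfG hG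
      _ ≤ 3 * ε := hGsum
      _ ≤ 4 * c / d := by rw [hεdef] at *; rw [mul_div_assoc]; nlinarith
  · -- (8.3.2)
    intro k
    have hw0 : ∀ x : Site d, 0 ≤ 1 - Real.cos (kdot k x) := fun x => by linarith [Real.cos_le_one (kdot k x)]
    have hsumk : ∀ N, Summable fun x => (1 - Real.cos (kdot k x)) * lacePi d p N x := fun N => ((HN N).2 k).1
    have hlek : ∀ N, ∑' x, (1 - Real.cos (kdot k x)) * lacePi d p N x ≤ (1 - Dhat d k) * ε ^ max (N - 1) 1 :=
      fun N => ((HN N).2 k).2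
    have hgeo2 := hasSum_pow_max_sub_one hε0 hε1
    have hout : Summable fun N => ∑' x, (1 - Real.cos (kdot k x)) * lacePi d p N x :=
      Summable.of_nonneg_of_le (fun N => tsum_nonneg fun x => mul_nonneg (hw0 x) (lacePi_nonneg p N x)) hlek
        (hgeo2.summable.mul_left _)
    have hfamk : Summable (Function.uncurry fun N x => (1 - Real.cos (kdot k x)) * lacePi d p N x) :=
      (summable_prod_of_nonneg fun q => mul_nonneg (hw0 q.2) (lacePi_nonneg p q.1 q.2)).2 ⟨hsumk, hout⟩
    have hGk : Summable fun x => (1 - Real.cos (kdot k x)) * G x := by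
      refine (hfamk.prod_symm.prod).congr fun x => ?_
      show ∑' N, (1 - Real.cos (kdot k x)) * lacePi d p N x = (1 - Real.cos (kdot k x)) * G x
      rw [tsum_mul_left]
    have hle1 : ∀ x, (1 - Real.cos (kdot k x)) * |Pf x| ≤ (1 - Real.cos (kdot k x)) * G x := fun x =>
      mul_le_mul_of_nonneg_left (hPfG x) (hw0 x)
    calc ∑' x, (1 - Real.cos (kdot k x)) * |Pf x|
        ≤ ∑' x, (1 - Real.cos (kdot k x)) * G x :=
          (Summable.of_nonneg_of_le (fun x => mul_nonneg (hw0 x) (abs_nonneg _)) hle1 hGk).tsum_le_tsum hle1 hGk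
      _ = ∑' x, ∑' N, (1 - Real.cos (kdot k x)) * lacePi d p N x := by
          refine tsum_congr fun x => ?_; rw [tsum_mul_left]
      _ = ∑' N, ∑' x, (1 - Real.cos (kdot k x)) * lacePi d p N x := hfamk.tsum_comm
      _ ≤ ∑' N, (1 - Dhat d k) * ε ^ max (N - 1) 1 := hout.tsum_le_tsum hlek (hgeo2.summable.mul_left _)
      _ = (1 - Dhat d k) * ∑' N, ε ^ max (N - 1) 1 := tsum_mul_left
      _ ≤ (1 - Dhat d k) * (4 * ε) :=
          mul_le_mul_of_nonneg_left (tsum_pow_max_sub_one_le hε0 hε) (one_sub_Dhat_nonneg k)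
      _ = 4 * c / d * (1 - Dhat d k) := by rw [hεdef]; ring
  · -- the identity (6.1.2) and its transform
    intro k
    -- abbreviations
    set Jτ : Site d → ℝ := latticeConv (bondJ d p) (tau d p 0) with hJτdef
    have hq0 : (0 : ℝ) ≤ 2 * d * (p : ℝ) := by have := p.2.1; positivity
    have hτs : Summable (tau d p 0) := summable_tau_of_lt_criticalProb hd2 p hp
    have hJs : Summable (bondJ d p) := summable_bondJ hd1 p
    have hJτ0 : ∀ x, 0 ≤ Jτ x := fun x => latticeConv_nonneg (bondJ_nonneg p) (fun y => tau_nonneg p 0 y) x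
    have hJτle : ∀ x, Jτ x ≤ 2 * d * (p : ℝ) := fun x =>
      latticeConv_bondJ_le hd1 p (fun y => tau_nonneg p 0 y) (fun y => tau_le_one p 0 y) x
    have hJτs : Summable Jτ := summable_latticeConv_of_summable hJs hτs
    have hJτsymm : ∀ x, Jτ (-x) = Jτ x := fun x => latticeConv_neg (bondJ_neg p) (tau_zero_symm p) x
    -- Step 1: `M → ∞` in (6.2.2)
    -- `Π_M(u) → Π(u)`
    have h1u : ∀ u, Tendsto (fun M => lacePiM d p M u) atTop (𝓝 (Pf u)) := fun u => by
      have h := (hsumPfN u).hasSum.tendsto_sum_nat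
      have h' := h.comp (tendsto_add_atTop_nat 1)
      refine h'.congr fun M => ?_
      simp only [Function.comp_apply, lacePiM_def]
    have hlim : ∀ x, tau d p 0 x = delta0 x + Jτ x + latticeConv Pf Jτ x + Pf x := by
      intro x
      have h1 := h1u x
      -- `|Π_M(u)| ≤ G(u)`
      have hPiMG : ∀ M u, |lacePiM d p M u| ≤ G u := fun M u => by
        rw [lacePiM_def]
        calc |∑ N ∈ Finset.range (M + 1), (-1 : ℝ) ^ N * lacePi d p N u|
            ≤ ∑ N ∈ Finset.range (M + 1), |(-1 : ℝ) ^ N * lacePi d p N u| := Finset.abs_sum_le_sum_abs _ _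
          _ = ∑ N ∈ Finset.range (M + 1), lacePi d p N u := Finset.sum_congr rfl fun N _ => habsN N u
          _ ≤ G u := (hsumN u).sum_le_tsum _ fun N _ => lacePi_nonneg p N u
      -- `(Π_M ⋆ Jτ)(x) → (Π ⋆ Jτ)(x)` (dominated convergence, majorant `2dp·G`)
      have h2 : Tendsto (fun M => latticeConv (lacePiM d p M) Jτ x) atTop (𝓝 (latticeConv Pf Jτ x)) := by
        unfold latticeConv
        refine tendsto_tsum_of_dominated_convergence (bound := fun u => G u * (2 * d * (p : ℝ)))
          (hG.mul_right _) (fun u => (h1u u).mul_const _) (Eventually.of_forall fun M u => ?_)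
        rw [norm_mul, Real.norm_eq_abs, Real.norm_eq_abs, abs_of_nonneg (hJτ0 _)]
        exact mul_le_mul (hPiMG M u) (hJτle _) (hJτ0 _) (hG0 u)
      -- `R_M(x) → 0`
      have h3 : Tendsto (fun M => laceR d p M x) atTop (𝓝 0) := by
        refine squeeze_zero_norm' (a := fun M => ε ^ M * (2 * d * (p : ℝ))) ?_ ?_
        · refine eventually_atTop.2 ⟨1, fun M hM => ?_⟩
          rw [Real.norm_eq_abs]
          have hfun : (fun u => (lacePiT d p M u).toReal) = lacePi d p M :=
            funext fun u => (lacePi_of_ne (Or.inl (by omega))).symm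
          calc |laceR d p M x| ≤ latticeConv (fun u => (lacePiT d p M u).toReal) Jτ x := h632 d hd2 p hp M x
            _ = latticeConv (lacePi d p M) Jτ x := by rw [hfun]
            _ ≤ (∑' u, lacePi d p M u) * (2 * d * (p : ℝ)) :=
                latticeConv_le_tsum_mul (hsum M) (lacePi_nonneg p M) hJτ0 hJτle x
            _ ≤ ε ^ max M 1 * (2 * d * (p : ℝ)) := mul_le_mul_of_nonneg_right (hle M) hq0
            _ = ε ^ M * (2 * d * (p : ℝ)) := by rw [show max M 1 = M by omega]
        · simpa using (tendsto_pow_atTop_nhds_zero_of_lt_one hε0 hε1).mul_const (2 * d * (p : ℝ))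
      have hconst : Tendsto (fun M => delta0 x + Jτ x + latticeConv (lacePiM d p M) Jτ x + lacePiM d p M x
          + laceR d p M x) atTop (𝓝 (tau d p 0 x)) :=
        tendsto_const_nhds.congr fun M => (h61 d hd2 p hp M x)
      have hlim' : Tendsto (fun M => delta0 x + Jτ x + latticeConv (lacePiM d p M) Jτ x + lacePiM d p M x
          + laceR d p M x) atTop (𝓝 (delta0 x + Jτ x + latticeConv Pf Jτ x + Pf x + 0)) :=
        (((tendsto_const_nhds.add tendsto_const_nhds).add h2).add h1).add h3
      have := tendsto_nhds_unique hconst hlim'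
      rw [this, add_zero]
    -- Step 2: the cosine transform of (6.1.2)
    have hPJs : Summable (latticeConv Pf Jτ) := summable_latticeConv_of_summable hPf hJτs
    have hδs : Summable (delta0 : Site d → ℝ) := hasSum_delta0.summable
    have hFT : tauHat d p k = 1 + cosFT Jτ k + cosFT Pf k * cosFT Jτ k + cosFT Pf k := by
      rw [tauHat_eq_cosFT, show tau d p 0 = fun x => ((delta0 x + Jτ x) + latticeConv Pf Jτ x) + Pf x from
        funext hlim, cosFT_add ((hδs.add hJτs).add hPJs) hPf, cosFT_add (hδs.add hJτs) hPJs,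
        cosFT_add hδs hJτs, cosFT_delta0, cosFT_latticeConv hPf hJτs hJτsymm]
    have hJτFT : cosFT Jτ k = 2 * d * (p : ℝ) * Dhat d k * tauHat d p k := by
      rw [hJτdef, cosFT_latticeConv hJs hτs (tau_zero_symm p), cosFT_bondJ, tauHat_eq_cosFT]
    rw [hJτFT] at hFT
    linear_combination hFT

end Assembly

/-- **Lemma 8.12 … and the Hara–Slade infrared bound reduced to Prop. 6.1, (6.3.2), Lemma 8.4 and
the symmetry of `Π^{(N)}`**: combined with `HaraSlade1990_infraredBound_of_prop83`
(`GaussianDominationRouteF3.lean`). [cite: HeydenreichVanDerHofstad2017, Thm. 5.1 and Chs. 6–8]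
[cite: HaraSlade1990, Thm. 1.1] -/
theorem HaraSlade1990_infraredBound_of_prop61_eq632_lemma84 (h61 : HvdH2017_prop61) (h632 : HvdH2017_eq632)
    (h84 : HvdH2017_lemma84) (hsymm : HvdH2017_piN_symm) : HaraSlade1990_infraredBound :=
  HaraSlade1990_infraredBound_of_prop83 (HvdH2017_prop83_of_prop61_eq632_lemma84 h61 h632 h84 hsymm)

end Literature.Barriers.CriticalPhenomena

end
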